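import Literature.MathematicalPhysics.QuantumFieldTheory.O2ThreeScalarSystem
import HarnessLib

/-!
# Ward-directed stress tensor and current in the `O(2)` three-scalar system: the reduced obligations

Topic: `Literature/MathematicalPhysics/QuantumFieldTheory` (conformal bootstrap; verifier-B / `certsdp` client path
of the ENGINES group).  HONEST FRAMING: shared numerical engines serving client cells; rigour lives in the verifiers;
every published number belongs to a client cell's ledger, not to the engines group.  A Literature module: published
statements re-proved in the kernel over the tree's own objects — no named facts, no `sorry`, nothing numerical.

## Why this file

`O2ThreeScalarSystem.lean` types the axioms A1–A4 of Chester–Landry–Liu–Poland–Simmons-Duffin–Su–Vichi, *Carving out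
OPE space and precise O(2) model critical exponents*, JHEP 06 (2020) 142 [ChesterEtAl2020], and the positivity
obligations `IsPositiveFor` of §3.1–§3.2, DELIBERATELY omitting the Ward identities ("WHAT THE AXIOMS DO NOT SAY":
*the Ward identities expressing `λ_{𝒪𝒪T}`, `λ_{𝒪𝒪J}` through `C_T`, `C_J`*).  Consequently `IsPositiveFor` asks, at
the exactly-placed stress tensor `(ℓ, Δ) = (2, 3)` of charge `0⁺` and current `(ℓ, Δ) = (1, 2)` of charge `0⁻`, for
positive SEMI-DEFINITENESS of `α(V⃗_{0⁺,3,2})` (`3 × 3`) and `α(V⃗_{0⁻,2,1})` (`2 × 2`) — positivity for EVERY coupling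
vector.  The source's island computation does not impose that: *"The stress tensor and conserved current are
assumed in the spectrum with coefficients constrained by Ward identities"* (§4), namely (§2.2)

> The OPE coefficients of `J^μ` and `T^{μν}` are constrained by Ward identities in terms of the two-point coefficients
> `C_J` and `C_T`. In our conventions, we have `λ²_{𝒪𝒪T} = Δ_𝒪² / (2C_T/C_T^free)`, `λ²_{𝒪𝒪J} = q_𝒪² / (2C_J/C_J^free)`,
> where `C^free_{J,T}` are the two-point coefficients of `J` and `T` in the free `O(2)` model. Thus, the contribution
> of these operators to the crossing equation can be parametrized purely in terms of `C_T` and `C_J`, together with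
> the dimensions and charges of the external scalars `φ, s, t`.

so `T` and `J` enter the crossing equation as ONE vector each, times the positive unknowns `C_T^free/(2C_T)`,
`C_J^free/(2C_J)`, and a functional produced by the solver is only certified non-negative on those single DIRECTIONS
of coupling space — `w_T ∥ (λ_{ssT}, λ_{φφT}, λ_{ttT})`, `w_J ∥ (λ_{φφJ}, λ_{ttJ})` — not on the whole cones.  A
verifier replaying such a functional against `IsPositiveFor` would be asked for more than the source proved.  This
file supplies the faithful variant: the extra axiom A5 (`IsWardDirected`: every `0⁺` multiplet at `(2,3)` has
couplings proportional to `w_T`, every `0⁻` multiplet at `(1,2)` couplings proportional to `w_J`), the REDUCED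
obligations `IsPositiveForWard` (the two semidefinite conditions at `(2,3)` and `(1,2)` replaced by the scalar
inequalities `w_Tᵀ α(V⃗_{0⁺,3,2}[g]) w_T ≥ 0`, `w_Jᵀ α(V⃗_{0⁻,2,1}[g]) w_J ≥ 0`, everything else as in `IsPositiveFor`),
and the exclusion theorem `boxExcludedWard_of_pointFunctionals` for data satisfying A1–A5.  The directions are
PARAMETERS (`wT wJ : Dims → …`): the source's relation displays squares only, so the componentwise signs of the
physical direction are a convention of the source that this file does not adjudicate; `chesterWardT D = (Δs, Δφ, Δt)`
and `chesterWardJ = (q_φ, q_t) = (1, 2)` record the moduli it states.  Every theorem holds for arbitrary directions.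

## What is proved

* §2 `IsWardDirected` (A5) and `SatisfiesO2WardAxioms = SatisfiesO2Axioms ∧ A5`; `BoxExcludedWard`, `O2EnclosureWard`
  with the assembly lemmas (`mono`, `union`, `of_boxExcluded` — an exclusion under A1–A4 is one under A1–A5 a
  fortiori — and `o2EnclosureWard_of_cover`).
* §3 `IsPositiveForWard` and `isPositiveForWard_of_isPositiveFor`: the reduced obligations are WEAKER than
  `IsPositiveFor`, for any directions.
* §4 `false_of_functional₂₂_termwise` (the exclusion step of [ChesterEtAl2020, §3.1] with termwise signs instead of
  semidefiniteness) and **`boxExcludedWard_of_pointFunctionals`**: if at every `D ∈ Q` and every class `[l]` a point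
  functional satisfies `IsPositiveForWard _ A D l (wT D) (wJ D)`, then no datum satisfying A1–A5 against `A` with
  directions `wT D, wJ D` has its external dimensions in `Q`; `boxExcludedWard_of_pointFunctionals_strong` (the strong external
  condition `α(V⃗_ext) ⪰ 0` of §3.2 instead of the class-wise one) and `_full` (from unreduced `IsPositiveFor` obligations).

HONEST LIMITS.  The Ward RELATION itself (the values of `λ_{𝒪𝒪T}`, `λ_{𝒪𝒪J}` in terms of `C_T`, `C_J`) is not used —
only proportionality to a fixed direction, which is all the island computation uses; the `C_T`, `C_J` bounds of §4.3
are out of scope.  The signs inside the physical directions are the source's convention (see above).  Uniqueness of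
the stress tensor / current at their `(ℓ, Δ)` is not assumed: A5 constrains every multiplet placed there, which under
A4 (twist gap `δτ > 0` above `T` and `J`) is what the source's set-up amounts to.  Nothing numerical.

## References
* S. M. Chester, W. Landry, J. Liu, D. Poland, D. Simmons-Duffin, N. Su, A. Vichi, *Carving out OPE space and precise
  O(2) model critical exponents*, JHEP 06 (2020) 142, arXiv:1912.03324, §2.2 (Ward identities for `λ_{𝒪𝒪T}`,
  `λ_{𝒪𝒪J}`), §3.1–§3.3, §4 ("coefficients constrained by Ward identities"). [cite: ChesterEtAl2020]
-/

noncomputable section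

open Set Finset Matrix
open Literature.MathematicalPhysics.QuantumFieldTheory.ONVectorSumRule
open Literature.MathematicalPhysics.QuantumFieldTheory.O2ThreeScalarCrossing
open Literature.MathematicalPhysics.QuantumFieldTheory.O2ThreeScalarSystem
open Literature.MathematicalPhysics.QuantumFieldTheory.ConformalBootstrap3D

namespace Literature.MathematicalPhysics.QuantumFieldTheory.O2WardObligations

/-! ## 1. The Ward directions stated by the source (moduli) -/

/-- The moduli of the stress-tensor direction: `|λ_{𝒪𝒪T}| ∝ Δ_𝒪` for `𝒪 = s, φ, t`, from
`λ²_{𝒪𝒪T} = Δ_𝒪² / (2C_T/C_T^free)` (componentwise signs are the source's convention, see the module docstring).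
[cite: ChesterEtAl2020, §2.2 (Ward identities, `λ²_{𝒪𝒪T}`)] -/
def chesterWardT (D : Dims) : Fin 3 → ℝ := ![D.Δs, D.Δφ, D.Δt]

/-- The moduli of the current direction: `|λ_{𝒪𝒪J}| ∝ q_𝒪` with charges `(q_φ, q_t) = (1, 2)`, from
`λ²_{𝒪𝒪J} = q_𝒪² / (2C_J/C_J^free)` (the neutral `s` does not couple to `J`). [cite: ChesterEtAl2020, §2.2 (Ward identities, `λ²_{𝒪𝒪J}`)] -/
def chesterWardJ : Fin 2 → ℝ := ![1, 2]

/-! ## 2. Axiom A5 and the Ward-restricted exclusion statements -/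

/-- **A5 — Ward-directed stress tensor and current.**  Every `0⁺` multiplet placed at `(ℓ, Δ) = (2, 3)` has couplings
`(λ_{ss}, λ_{φφ}, λ_{tt}) = κ w_T`, and every `0⁻` multiplet placed at `(ℓ, Δ) = (1, 2)` has `(λ_{φφ}, λ_{tt}) = κ w_J`,
for some real `κ` (= `(C^free/2C)^{1/2}` up to sign in the source).
[cite: ChesterEtAl2020, §2.2 (Ward identities: "parametrized purely in terms of `C_T` and `C_J`")] -/
def IsWardDirected (X : O2Data) (wT : Fin 3 → ℝ) (wJ : Fin 2 → ℝ) : Prop :=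
  (∀ i, X.ℓ0p i = 2 → X.Δ0p i = 3 → ∃ κ : ℝ, X.a0 i = κ * wT 0 ∧ X.b0 i = κ * wT 1 ∧ X.c0 i = κ * wT 2) ∧
    ∀ i, X.ℓ0m i = 1 → X.Δ0m i = 2 → ∃ κ : ℝ, X.b0m i = κ * wJ 0 ∧ X.c0m i = κ * wJ 1

/-- The axioms A1–A5: the typed axioms of `O2ThreeScalarSystem` together with Ward-directedness for the directions
`wT X.D`, `wJ X.D`. [cite: ChesterEtAl2020, §2.2 (assumptions about the spectrum; Ward identities)] -/
def SatisfiesO2WardAxioms (X : O2Data) (A : O2Gaps) (wT : Dims → Fin 3 → ℝ) (wJ : Dims → Fin 2 → ℝ) : Prop :=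
  X.SatisfiesO2Axioms A ∧ IsWardDirected X (wT X.D) (wJ X.D)

/-- `Q` is excluded against A1–A5: no datum satisfying them has `(Δ_s, Δ_φ, Δ_t) ∈ Q`.
[cite: ChesterEtAl2020, §3.3 (allowed and disallowed points)] -/
def BoxExcludedWard (A : O2Gaps) (wT : Dims → Fin 3 → ℝ) (wJ : Dims → Fin 2 → ℝ) (Q : Set (ℝ × ℝ × ℝ)) : Prop :=
  ∀ X : O2Data, SatisfiesO2WardAxioms X A wT wJ → (X.D.Δs, X.D.Δφ, X.D.Δt) ∉ Q

/-- Windowed enclosure against A1–A5. [cite: ChesterEtAl2020, §3.3 (allowed and disallowed points)] -/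
def O2EnclosureWard (A : O2Gaps) (wT : Dims → Fin 3 → ℝ) (wJ : Dims → Fin 2 → ℝ) (W R : Set (ℝ × ℝ × ℝ)) :
    Prop :=
  ∀ X : O2Data, SatisfiesO2WardAxioms X A wT wJ → (X.D.Δs, X.D.Δφ, X.D.Δt) ∈ W → (X.D.Δs, X.D.Δφ, X.D.Δt) ∈ R

section Assembly
variable {A : O2Gaps} {wT : Dims → Fin 3 → ℝ} {wJ : Dims → Fin 2 → ℝ} {Q Q' W R : Set (ℝ × ℝ × ℝ)}

/-- An exclusion under A1–A4 is an exclusion under A1–A5, a fortiori.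
[cite: ChesterEtAl2020, §2.2 (assumptions about the spectrum)] -/
theorem BoxExcludedWard.of_boxExcluded (h : BoxExcluded A Q) : BoxExcludedWard A wT wJ Q :=
  fun X hX => h X hX.1

/-- Subsets of an excluded set are excluded. [cite: ChesterEtAl2020, §3.3 (allowed and disallowed points)] -/
theorem BoxExcludedWard.mono (h : BoxExcludedWard A wT wJ Q) (hQ : Q' ⊆ Q) : BoxExcludedWard A wT wJ Q' :=
  fun X hX hmem => h X hX (hQ hmem)

/-- Excluded sets are closed under union. [cite: ChesterEtAl2020, §3.3 (allowed and disallowed points)] -/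
theorem BoxExcludedWard.union (h : BoxExcludedWard A wT wJ Q) (h' : BoxExcludedWard A wT wJ Q') :
    BoxExcludedWard A wT wJ (Q ∪ Q') :=
  fun X hX hmem => hmem.elim (h X hX) (h' X hX)

/-- An enclosure under A1–A4 is an enclosure under A1–A5. [cite: ChesterEtAl2020, §2.2 (assumptions about the spectrum)] -/
theorem O2EnclosureWard.of_o2Enclosure (h : O2Enclosure A W R) : O2EnclosureWard A wT wJ W R :=
  fun X hX => h X hX.1

/-- **Assembly of a certificate** under A1–A5: if `W ⊆ R ∪ ⋃ᵢ Qᵢ` and every `Qᵢ` is excluded, then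
`O2EnclosureWard A wT wJ W R`. [cite: ChesterEtAl2020, §3.3 (allowed and disallowed points)] -/
theorem o2EnclosureWard_of_cover {ι : Type*} (Qs : ι → Set (ℝ × ℝ × ℝ)) (hcov : W ⊆ R ∪ ⋃ i, Qs i)
    (hQ : ∀ i, BoxExcludedWard A wT wJ (Qs i)) : O2EnclosureWard A wT wJ W R := by
  intro X hX hmem
  rcases hcov hmem with hR | hQ'
  · exact hR
  · obtain ⟨i, hi⟩ := Set.mem_iUnion.mp hQ'
    exact ((hQ i) X hX hi).elim

end Assembly

/-! ## 3. The reduced obligations -/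

/-- **The functional conditions with Ward-directed `T` and `J`.**  As `IsPositiveFor α A D l`, except that at
`(ℓ, Δ) = (2, 3)` in `0⁺` only `w_Tᵀ α(V⃗_{0⁺}[g]) w_T ≥ 0` is asked and at `(ℓ, Δ) = (1, 2)` in `0⁻` only
`w_Jᵀ α(V⃗_{0⁻}[g]) w_J ≥ 0` (for every genuine block family there); semidefiniteness is asked at all OTHER admissible
`(Δ, ℓ)`. [cite: ChesterEtAl2020, §3.1 (functional conditions), §2.2 (Ward identities), §4 ("coefficients constrained by Ward identities")] -/
def IsPositiveForWard (α : (ℝ → ℝ → Fin 22 → ℝ) →ₗ[ℝ] ℝ) (A : O2Gaps) (D : Dims) (l : Fin 4 → ℝ)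
    (wT : Fin 3 → ℝ) (wJ : Fin 2 → ℝ) : Prop :=
  0 < ![(1 : ℝ), 1, 1] ⬝ᵥ (alphaMat α (V0p D unitBlocks) *ᵥ ![(1 : ℝ), 1, 1]) ∧
    (∀ gs gφ gt : Label → ℝ → ℝ → ℝ, GenuineOn D labels0p D.Δs 0 gs → GenuineOn D labels1 D.Δφ 0 gφ →
      GenuineOn D labels2p D.Δt 0 gt → 0 ≤ l ⬝ᵥ (alphaMat α (Vext D gs gφ gt) *ᵥ l)) ∧
    (∀ (Δ : ℝ) (ℓ : ℕ) (g : Label → ℝ → ℝ → ℝ), A.Allows0p Δ ℓ → ¬(ℓ = 2 ∧ Δ = 3) →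
      GenuineOn D labels0p Δ ℓ g → (alphaMat α (V0p D g)).PosSemidef) ∧
    (∀ g : Label → ℝ → ℝ → ℝ, GenuineOn D labels0p 3 2 g → 0 ≤ wT ⬝ᵥ (alphaMat α (V0p D g) *ᵥ wT)) ∧
    (∀ (Δ : ℝ) (ℓ : ℕ) (g : Label → ℝ → ℝ → ℝ), A.Allows0m Δ ℓ → ¬(ℓ = 1 ∧ Δ = 2) →
      GenuineOn D labels0m Δ ℓ g → (alphaMat α (V0m D g)).PosSemidef) ∧
    (∀ g : Label → ℝ → ℝ → ℝ, GenuineOn D labels0m 2 1 g → 0 ≤ wJ ⬝ᵥ (alphaMat α (V0m D g) *ᵥ wJ)) ∧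
    (∀ (Δ : ℝ) (ℓ : ℕ) (g : Label → ℝ → ℝ → ℝ), A.Allows1 Δ ℓ → GenuineOn D labels1 Δ ℓ g →
      (alphaMat α (V1 D ((-1) ^ ℓ) g)).PosSemidef) ∧
    (∀ (Δ : ℝ) (ℓ : ℕ) (g : Label → ℝ → ℝ → ℝ), A.Allows2p Δ ℓ → GenuineOn D labels2p Δ ℓ g →
      (alphaMat α (V2p D g)).PosSemidef) ∧
    (∀ (Δ : ℝ) (ℓ : ℕ) (g : Label → ℝ → ℝ → ℝ), A.Allows2m Δ ℓ → GenuineOn D labels2m Δ ℓ g →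
      0 ≤ α (V2m D g)) ∧
    (∀ (Δ : ℝ) (ℓ : ℕ) (g : Label → ℝ → ℝ → ℝ), A.Allows3 Δ ℓ → GenuineOn D labels3 Δ ℓ g →
      0 ≤ α (V3 D ((-1) ^ ℓ) g)) ∧
      ∀ (Δ : ℝ) (ℓ : ℕ) (g : Label → ℝ → ℝ → ℝ), A.Allows4 Δ ℓ → GenuineOn D labels4 Δ ℓ g →
        0 ≤ α (V4 D g)

/-- **The reduced obligations are weaker**: `IsPositiveFor α A D l` implies `IsPositiveForWard α A D l w_T w_J` for ANY
directions (semidefiniteness gives the scalar inequality at every vector; the slots `(2,3)`, `(1,2)` are admissible).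
[cite: ChesterEtAl2020, §3.1 (functional conditions)] -/
theorem isPositiveForWard_of_isPositiveFor {α : (ℝ → ℝ → Fin 22 → ℝ) →ₗ[ℝ] ℝ} {A : O2Gaps} {D : Dims}
    {l : Fin 4 → ℝ} (h : IsPositiveFor α A D l) (wT : Fin 3 → ℝ) (wJ : Fin 2 → ℝ) :
    IsPositiveForWard α A D l wT wJ := by
  obtain ⟨hunit, hext, p0p, p0m, p1, p2p, p2m, p3, p4⟩ := h
  refine ⟨hunit, hext, fun Δ ℓ g ha _ hg => p0p Δ ℓ g ha hg, fun g hg => ?_,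
    fun Δ ℓ g ha _ hg => p0m Δ ℓ g ha hg, fun g hg => ?_, p1, p2p, p2m, p3, p4⟩
  · have hT : A.Allows0p 3 2 :=
      ⟨⟨1, rfl⟩, by norm_num [unitarityBound3D], fun h => by norm_num at h, fun _ => Or.inl ⟨rfl, rfl⟩⟩
    have := (p0p 3 2 g hT hg).dotProduct_mulVec_nonneg wT
    rwa [star_trivial] at this
  · have hJ : A.Allows0m 2 1 := ⟨⟨0, rfl⟩, by norm_num [unitarityBound3D], Or.inl ⟨rfl, rfl⟩⟩
    have := (p0m 2 1 g hJ hg).dotProduct_mulVec_nonneg wJ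
    rwa [star_trivial] at this

/-! ## 4. Exclusion under A1–A5 from the reduced obligations -/

/-- A coupling vector proportional to a direction contributes `κ²` times the direction's quadratic form:
`(κw) ⬝ (α(V⃗) (κw)) = κ² · w ⬝ (α(V⃗) w)`. [cite: ChesterEtAl2020, §2.2 ("parametrized purely in terms of `C_T` and `C_J`")] -/
theorem quadForm_smul {n : ℕ} (α : (ℝ → ℝ → Fin 22 → ℝ) →ₗ[ℝ] ℝ)
    (V : ℝ → ℝ → Fin 22 → Matrix (Fin n) (Fin n) ℝ) (κ : ℝ) (w : Fin n → ℝ) :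
    (κ • w) ⬝ᵥ (alphaMat α V *ᵥ (κ • w)) = κ ^ 2 * (w ⬝ᵥ (alphaMat α V *ᵥ w)) := by
  rw [Matrix.mulVec_smul, dotProduct_smul, smul_dotProduct, smul_eq_mul, smul_eq_mul]
  ring

/-- **The exclusion step with termwise signs** — the argument of [ChesterEtAl2020, §3.1] needs of each exchanged
`0⁺`, `0⁻`, charge-`1`, `2⁺` multiplet only that `α` of ITS summand is `≥ 0` (semidefiniteness is one way to get that
for every coupling vector; a Ward-directed multiplet gets it from the scalar inequality on its direction).
[cite: ChesterEtAl2020, §3.1 (functional conditions; "the hypothetical spectrum is ruled out")] -/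
theorem false_of_functional₂₂_termwise (α : (ℝ → ℝ → Fin 22 → ℝ) →ₗ[ℝ] ℝ) (D : Dims)
    {ι0p ι0m ι1 ι2p ι2m ι3 ι4 : Type*}
    {a0 b0 c0 : ι0p → ℝ} {g0p : ι0p → Label → ℝ → ℝ → ℝ}
    {b0m c0m : ι0m → ℝ} {g0m : ι0m → Label → ℝ → ℝ → ℝ}
    {x1 y1 ε1 : ι1 → ℝ} {g1 : ι1 → Label → ℝ → ℝ → ℝ}
    {b2 z2 : ι2p → ℝ} {g2p : ι2p → Label → ℝ → ℝ → ℝ}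
    {p2m : ι2m → ℝ} {g2m : ι2m → Label → ℝ → ℝ → ℝ}
    {p3 ε3 : ι3 → ℝ} {g3 : ι3 → Label → ℝ → ℝ → ℝ}
    {p4 : ι4 → ℝ} {g4 : ι4 → Label → ℝ → ℝ → ℝ}
    {lam : Fin 4 → ℝ} {gs gφ gt : Label → ℝ → ℝ → ℝ} {A0p A0m A1 A2p A2m A3 A4 : ℝ}
    (hp2m : ∀ o, 0 ≤ p2m o) (hp3 : ∀ o, 0 ≤ p3 o) (hp4 : ∀ o, 0 ≤ p4 o)
    (h0p : HasSum (fun o => α (quad0p D (a0 o) (b0 o) (c0 o) (g0p o))) A0p)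
    (h0m : HasSum (fun o => α (quad0m D (b0m o) (c0m o) (g0m o))) A0m)
    (h1 : HasSum (fun o => α (quad1 D (x1 o) (y1 o) (ε1 o) (g1 o))) A1)
    (h2p : HasSum (fun o => α (quad2p D (b2 o) (z2 o) (g2p o))) A2p)
    (h2m : HasSum (fun o => p2m o * α (V2m D (g2m o))) A2m)
    (h3 : HasSum (fun o => p3 o * α (V3 D (ε3 o) (g3 o))) A3)
    (h4 : HasSum (fun o => p4 o * α (V4 D (g4 o))) A4)
    (hzero : α (quad0p D 1 1 1 unitBlocks) + α (quadVext D lam gs gφ gt) +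
      A0p + A0m + A1 + A2p + A2m + A3 + A4 = 0)
    (hunit : 0 < ![(1 : ℝ), 1, 1] ⬝ᵥ (alphaMat α (V0p D unitBlocks) *ᵥ ![(1 : ℝ), 1, 1]))
    (hext : 0 ≤ α (quadVext D lam gs gφ gt))
    (hpos0p : ∀ o, 0 ≤ α (quad0p D (a0 o) (b0 o) (c0 o) (g0p o)))
    (hpos0m : ∀ o, 0 ≤ α (quad0m D (b0m o) (c0m o) (g0m o)))
    (hpos1 : ∀ o, 0 ≤ α (quad1 D (x1 o) (y1 o) (ε1 o) (g1 o)))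
    (hpos2p : ∀ o, 0 ≤ α (quad2p D (b2 o) (z2 o) (g2p o)))
    (hpos2m : ∀ o, 0 ≤ α (V2m D (g2m o))) (hpos3 : ∀ o, 0 ≤ α (V3 D (ε3 o) (g3 o)))
    (hpos4 : ∀ o, 0 ≤ α (V4 D (g4 o))) : False := by
  have n0p : 0 ≤ A0p := h0p.nonneg hpos0p
  have n0m : 0 ≤ A0m := h0m.nonneg hpos0m
  have n1 : 0 ≤ A1 := h1.nonneg hpos1
  have n2p : 0 ≤ A2p := h2p.nonneg hpos2p
  have n2m : 0 ≤ A2m := h2m.nonneg fun o => mul_nonneg (hp2m o) (hpos2m o)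
  have n3 : 0 ≤ A3 := h3.nonneg fun o => mul_nonneg (hp3 o) (hpos3 o)
  have n4 : 0 ≤ A4 := h4.nonneg fun o => mul_nonneg (hp4 o) (hpos4 o)
  rw [alpha_quad0p] at hunit
  linarith

section Exclusion
variable {A : O2Gaps} {wT : Dims → Fin 3 → ℝ} {wJ : Dims → Fin 2 → ℝ} {Q : Set (ℝ × ℝ × ℝ)}

/-- The sign of a Ward-directed `0⁺` summand: if `(a, b, c) = κ w_T` and `w_Tᵀ α(V⃗_{0⁺}[g]) w_T ≥ 0` then
`α((a b c) V⃗_{0⁺}[g] (a;b;c)) = κ² · w_Tᵀ α(V⃗_{0⁺}[g]) w_T ≥ 0`. [cite: ChesterEtAl2020, §2.2 (Ward identities), §3.1] -/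
theorem quad0p_nonneg_of_ward (α : (ℝ → ℝ → Fin 22 → ℝ) →ₗ[ℝ] ℝ) (D : Dims) {a b c κ : ℝ} {w : Fin 3 → ℝ}
    (g : Label → ℝ → ℝ → ℝ) (ha : a = κ * w 0) (hb : b = κ * w 1) (hc : c = κ * w 2)
    (hw : 0 ≤ w ⬝ᵥ (alphaMat α (V0p D g) *ᵥ w)) : 0 ≤ α (quad0p D a b c g) := by
  have hv : (![a, b, c] : Fin 3 → ℝ) = κ • w := by
    ext i; fin_cases i <;> simp [ha, hb, hc]
  rw [← alpha_quad0p, hv, quadForm_smul]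
  exact mul_nonneg (sq_nonneg κ) hw

/-- The sign of a Ward-directed `0⁻` summand, likewise. [cite: ChesterEtAl2020, §2.2 (Ward identities), §3.1] -/
theorem quad0m_nonneg_of_ward (α : (ℝ → ℝ → Fin 22 → ℝ) →ₗ[ℝ] ℝ) (D : Dims) {b c κ : ℝ} {w : Fin 2 → ℝ}
    (g : Label → ℝ → ℝ → ℝ) (hb : b = κ * w 0) (hc : c = κ * w 1)
    (hw : 0 ≤ w ⬝ᵥ (alphaMat α (V0m D g) *ᵥ w)) : 0 ≤ α (quad0m D b c g) := by
  have hv : (![b, c] : Fin 2 → ℝ) = κ • w := by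
    ext i; fin_cases i <;> simp [hb, hc]
  have e : α (quad0m D b c g) = ![b, c] ⬝ᵥ (alphaMat α (V0m D g) *ᵥ ![b, c]) :=
    (alphaMat_quadForm α (V0m D g) ![b, c]).symm
  rw [e, hv, quadForm_smul]
  exact mul_nonneg (sq_nonneg κ) hw

/-- **Exclusion by point functionals under A1–A5.**  If at every `D ∈ Q` and for every class representative
`l ≠ 0` some point functional with evaluation points in the diamond satisfies the REDUCED obligations
`IsPositiveForWard _ A D l (w_T D) (w_J D)`, then `BoxExcludedWard A w_T w_J Q`.  Proof: as
`boxExcluded_of_pointFunctionals`, with the sign of each `0⁺`/`0⁻` summand supplied by semidefiniteness off the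
slots `(2,3)`, `(1,2)` and by A5 + the scalar inequality on them.
[cite: ChesterEtAl2020, §3.3 (allowed and disallowed points), §3.1 (functional conditions), §2.2 (Ward identities)] -/
theorem boxExcludedWard_of_pointFunctionals
    (h : ∀ D : Dims, (D.Δs, D.Δφ, D.Δt) ∈ Q → ∀ l : Fin 4 → ℝ, l ≠ 0 →
      ∃ (M : ℕ) (w : Fin M → Fin 22 → ℝ) (z zb : Fin M → ℝ),
        (∀ m, z m ∈ Ioo (0 : ℝ) 1) ∧ (∀ m, zb m ∈ Ioo (0 : ℝ) 1) ∧
          IsPositiveForWard (pointFunctional₂₂ w (fun m => z m * zb m) (fun m => (1 - z m) * (1 - zb m)))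
            A D l (wT D) (wJ D)) :
    BoxExcludedWard A wT wJ Q := by
  intro X hXW hQ
  obtain ⟨hX, hWT, hWJ⟩ := hXW
  obtain ⟨hA2, hA1, hA3, hA4⟩ := hX
  refine false_of_forall_class (P := fun l => ∃ (M : ℕ) (w : Fin M → Fin 22 → ℝ) (z zb : Fin M → ℝ),
    (∀ m, z m ∈ Ioo (0 : ℝ) 1) ∧ (∀ m, zb m ∈ Ioo (0 : ℝ) 1) ∧
      IsPositiveForWard (pointFunctional₂₂ w (fun m => z m * zb m) (fun m => (1 - z m) * (1 - zb m))) A X.D l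
        (wT X.D) (wJ X.D))
    X.lam (h X.D hQ) ?_
  rintro l c - hlam ⟨M, w, z, zb, hz, hzb, hpos⟩
  obtain ⟨hunit, hext, p0p, pT, p0m, pJ, p1, p2p, p2m, p3, p4⟩ := hpos
  obtain ⟨gs_ok, gφ_ok, gt_ok, b0p, b0m, b1, b2p, b2m, b3, b4⟩ := hA2
  choose T0p T0m T1 T2p T2m T3 T4 hT using fun m => hA3 (z m) (zb m) (hz m) (hzb m)
  set u : Fin M → ℝ := fun m => z m * zb m with hu
  set v : Fin M → ℝ := fun m => (1 - z m) * (1 - zb m) with hv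
  set α := pointFunctional₂₂ w u v with hα
  -- termwise signs of the `0⁺` and `0⁻` summands
  have s0p : ∀ i, 0 ≤ α (quad0p X.D (X.a0 i) (X.b0 i) (X.c0 i) (X.g0p i)) := by
    intro i
    by_cases hTi : X.ℓ0p i = 2 ∧ X.Δ0p i = 3
    · obtain ⟨κ, ha, hb, hc⟩ := hWT i hTi.1 hTi.2
      have hg : GenuineOn X.D labels0p 3 2 (X.g0p i) := by
        have hg := b0p i
        rw [hTi.1, hTi.2] at hg
        exact hg
      exact quad0p_nonneg_of_ward α X.D (X.g0p i) ha hb hc (pT _ hg)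
    · exact quadVec_nonneg_of_posSemidef α (p0p _ _ _ (X.allows0p hA1 hA4 i) hTi (b0p i)) _
  have s0m : ∀ i, 0 ≤ α (quad0m X.D (X.b0m i) (X.c0m i) (X.g0m i)) := by
    intro i
    by_cases hJi : X.ℓ0m i = 1 ∧ X.Δ0m i = 2
    · obtain ⟨κ, hb, hc⟩ := hWJ i hJi.1 hJi.2
      have hg : GenuineOn X.D labels0m 2 1 (X.g0m i) := by
        have hg := b0m i
        rw [hJi.1, hJi.2] at hg
        exact hg
      exact quad0m_nonneg_of_ward α X.D (X.g0m i) hb hc (pJ _ hg)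
    · exact quadVec_nonneg_of_posSemidef α (p0m _ _ _ (X.allows0m hA1 hA4 i) hJi (b0m i)) _
  refine false_of_functional₂₂_termwise α X.D (a0 := X.a0) (b0 := X.b0) (c0 := X.c0) (g0p := X.g0p)
    (b0m := X.b0m) (c0m := X.c0m) (g0m := X.g0m) (x1 := X.x1) (y1 := X.y1)
    (ε1 := fun i => (-1) ^ X.ℓ1 i) (g1 := X.g1) (b2 := X.b2) (z2 := X.z2) (g2p := X.g2p)
    (p2m := fun i => X.lam2m i ^ 2) (g2m := X.g2m) (p3 := fun i => X.lam3 i ^ 2)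
    (ε3 := fun i => (-1) ^ X.ℓ3 i) (g3 := X.g3) (p4 := fun i => X.lam4 i ^ 2) (g4 := X.g4)
    (lam := X.lam) (gs := X.gs) (gφ := X.gφ) (gt := X.gt)
    (A0p := ∑ m, ∑ r, w m r * T0p m r) (A0m := ∑ m, ∑ r, w m r * T0m m r)
    (A1 := ∑ m, ∑ r, w m r * T1 m r) (A2p := ∑ m, ∑ r, w m r * T2p m r)
    (A2m := ∑ m, ∑ r, w m r * T2m m r) (A3 := ∑ m, ∑ r, w m r * T3 m r)
    (A4 := ∑ m, ∑ r, w m r * T4 m r)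
    (fun i => sq_nonneg _) (fun i => sq_nonneg _) (fun i => sq_nonneg _)
    ?_ ?_ ?_ ?_ ?_ ?_ ?_ ?_ hunit (ext_nonneg_of_weak α (hext X.gs X.gφ X.gt gs_ok gφ_ok gt_ok) hlam)
    s0p s0m
    (fun i => quadVec_nonneg_of_posSemidef α (p1 _ _ _ (X.allows1 hA1 hA4 i) (b1 i)) _)
    (fun i => quadVec_nonneg_of_posSemidef α (p2p _ _ _ (X.allows2p hA1 hA4 i) (b2p i)) _)
    (fun i => p2m _ _ _ (X.allows2m hA1 hA4 i) (b2m i))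
    (fun i => p3 _ _ _ (X.allows3 hA1 hA4 i) (b3 i))
    (fun i => p4 _ _ _ (X.allows4 hA1 hA4 i) (b4 i))
  · exact hasSum_pointFunctional₂₂_pts w u v
      (f := fun i => quad0p X.D (X.a0 i) (X.b0 i) (X.c0 i) (X.g0p i)) fun m => (hT m).1
  · exact hasSum_pointFunctional₂₂_pts w u v
      (f := fun i => quad0m X.D (X.b0m i) (X.c0m i) (X.g0m i)) fun m => (hT m).2.1
  · exact hasSum_pointFunctional₂₂_pts w u v
      (f := fun i => quad1 X.D (X.x1 i) (X.y1 i) ((-1) ^ X.ℓ1 i) (X.g1 i)) fun m => (hT m).2.2.1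
  · exact hasSum_pointFunctional₂₂_pts w u v
      (f := fun i => quad2p X.D (X.b2 i) (X.z2 i) (X.g2p i)) fun m => (hT m).2.2.2.1
  · have := hasSum_pointFunctional₂₂_pts w u v (f := fun i => X.lam2m i ^ 2 • V2m X.D (X.g2m i))
      (T := T2m) fun m => (hT m).2.2.2.2.1
    simpa [map_smul, smul_eq_mul] using this
  · have := hasSum_pointFunctional₂₂_pts w u v
      (f := fun i => X.lam3 i ^ 2 • V3 X.D ((-1) ^ X.ℓ3 i) (X.g3 i)) (T := T3)
      fun m => (hT m).2.2.2.2.2.1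
    simpa [map_smul, smul_eq_mul] using this
  · have := hasSum_pointFunctional₂₂_pts w u v (f := fun i => X.lam4 i ^ 2 • V4 X.D (X.g4 i))
      (T := T4) fun m => (hT m).2.2.2.2.2.2.1
    simpa [map_smul, smul_eq_mul] using this
  · have key : ∀ m, quad0p X.D 1 1 1 unitBlocks (u m) (v m) +
        quadVext X.D X.lam X.gs X.gφ X.gt (u m) (v m) + T0p m + T0m m + T1 m + T2p m + T2m m + T3 m +
          T4 m = 0 := fun m => (hT m).2.2.2.2.2.2.2
    have hsum : ∑ m, ∑ r, w m r * (quad0p X.D 1 1 1 unitBlocks (u m) (v m) +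
        quadVext X.D X.lam X.gs X.gφ X.gt (u m) (v m) + T0p m + T0m m + T1 m + T2p m + T2m m + T3 m +
          T4 m) r = 0 :=
      Finset.sum_eq_zero fun m _ => Finset.sum_eq_zero fun r _ => by rw [key m, Pi.zero_apply, mul_zero]
    simpa only [hα, pointFunctional₂₂_apply, Pi.add_apply, mul_add, Finset.sum_add_distrib] using hsum

/-- The A1–A4 certificate theorem is recovered: obligations `IsPositiveFor` at every class exclude under A1–A5 too
(reduced obligations are weaker, `isPositiveForWard_of_isPositiveFor`). [cite: ChesterEtAl2020, §3.3 (allowed and disallowed points)] -/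
theorem boxExcludedWard_of_pointFunctionals_full
    (h : ∀ D : Dims, (D.Δs, D.Δφ, D.Δt) ∈ Q → ∀ l : Fin 4 → ℝ, l ≠ 0 →
      ∃ (M : ℕ) (w : Fin M → Fin 22 → ℝ) (z zb : Fin M → ℝ),
        (∀ m, z m ∈ Ioo (0 : ℝ) 1) ∧ (∀ m, zb m ∈ Ioo (0 : ℝ) 1) ∧
          IsPositiveFor (pointFunctional₂₂ w (fun m => z m * zb m) (fun m => (1 - z m) * (1 - zb m)))
            A D l) :
    BoxExcludedWard A wT wJ Q :=
  BoxExcludedWard.of_boxExcluded (boxExcluded_of_pointFunctionals h)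

/-- The reduced obligations with the STRONG external condition `α(V⃗_ext) ⪰ 0` (the "naive" set-up of §3.2) in
place of the class-wise one exclude under A1–A5 for every `λ_ext`.
[cite: ChesterEtAl2020, §3.2 (strong condition `α(V⃗_ext) ⪰ 0`), §2.2 (Ward identities)] -/
theorem boxExcludedWard_of_pointFunctionals_strong
    (h : ∀ D : Dims, (D.Δs, D.Δφ, D.Δt) ∈ Q →
      ∃ (M : ℕ) (w : Fin M → Fin 22 → ℝ) (z zb : Fin M → ℝ),
        (∀ m, z m ∈ Ioo (0 : ℝ) 1) ∧ (∀ m, zb m ∈ Ioo (0 : ℝ) 1) ∧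
          (∀ gs gφ gt : Label → ℝ → ℝ → ℝ, GenuineOn D labels0p D.Δs 0 gs →
            GenuineOn D labels1 D.Δφ 0 gφ → GenuineOn D labels2p D.Δt 0 gt →
              (alphaMat (pointFunctional₂₂ w (fun m => z m * zb m) (fun m => (1 - z m) * (1 - zb m)))
                (Vext D gs gφ gt)).PosSemidef) ∧
          IsPositiveForWard (pointFunctional₂₂ w (fun m => z m * zb m) (fun m => (1 - z m) * (1 - zb m)))
            A D 0 (wT D) (wJ D)) :
    BoxExcludedWard A wT wJ Q := by
  refine boxExcludedWard_of_pointFunctionals fun D hD l _ => ?_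
  obtain ⟨M, w, z, zb, hz, hzb, hstrong, hpos⟩ := h D hD
  exact ⟨M, w, z, zb, hz, hzb, hpos.1, extWeak_of_strong _ D hstrong l, hpos.2.2⟩

end Exclusion

end Literature.MathematicalPhysics.QuantumFieldTheory.O2WardObligations

end
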